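import Summits.QuantumFields.YangMills.Theorems.BalabanUVNodesN15PairedFamilyGuard

/-!
# Route «BalabanUVNodes», cluster K4 «SpineRates» — node N15 = NE2: R3 CONTROL FOR THE K3⁷ v2 DRAFT-2 «GUARDS CONJOINED» — the ZERO-KERNEL reading PASSES `KeyedLive` AND
# carries `N15At` at the bundle of record (door (J3) of file 1, made a concrete inhabitant): the N15 slot of `GuardedReading ∧ KeyedRatesHolderD4` is still closable
# without an estimate; the cure is the PIN BY NAME of the kernels, not a further carrier guard (W-SEAT-START-LIST §2 n15 ITEM 2, file 3)

Cell `pub-ymgap`, WIDTH SEAT `pub-ymgap-dag-n15-w2` (director-ym №197 ∕ HUMAN RULING D-0149), generation 0, file 3.  Filed `--kind proof --supports stmt-QuantumFields-20544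
--as helper` — COUNT-NEUTRAL; theorems only (0 `def`, 0 `sorry`); imports file 1 `BalabanUVNodesN15PairedFamilyGuard` (p584544: `Live`, `KeyedLive`, `n15At_of_kernels_zero`);
nothing in the tree is modified or re-declared.

WHY.  Plan g79 [YMPLAN-G79-K3V2-DRAFT2] (pub-ymgap INBOX l.24835): stub 1 of the v2 draft reads `∃ β ∈ ]2/3,1[, ∃ 𝔯 ksel, GuardedReading 𝔯 ksel ∧ KeyedRatesHolderD4 β
(rrOfRecord 𝔯 ksel)` with `GuardedReading 𝔯 ksel := Ne1NondegenerateOn 𝔯 … ∧ KeyedLive (rrOfRecord 𝔯 ksel) ∧ KeyedSensitive 𝔯 ksel`, and asks: «if you see a junk inhabitant of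
DRAFT-2's stub 1 that PASSES `GuardedReading`, one line on the bus kills the draft before registration».  File 1 recorded door (J3) abstractly (`n15At_of_kernels_zero`: zero
kernels carry all three NE2⁺ layers on every sign-sane family, live or not).  THIS FILE MAKES IT A CONCRETE INHABITANT OF THE N15 SLOT: the reading whose paired family is
the -a lane's LIVE knit carrier family (`NE2NodeTorus.knitInstance 3 L`, size parameter and scale count free) with ALL THREE KERNEL FAMILIES ZERO passes `KeyedLive` at the
bundle of record for every run-length selector and carries `N15At` there — no estimate anywhere.  READING FOR THE PLAN: `KeyedLive` (a CARRIER guard) is necessary and does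
its job (evidence #5's empty family, the bounded-`M` families fail it); it cannot see the kernels.  A kernel-level «sensitivity» guard has no honest formulation (a kernel
`θ^{2k}·[y = y′]` passes any non-vanishing test and every layer); the cure is to PIN `(rrOfRecord 𝔯 ksel …).ne2` — objects INCLUDING kernels — BY NAME: today to a
constructed model family (dag-n15-a g18 PROGRAMME S `…FullPropagatorSized…`: Bałaban's genuine `U ≡ 1` objects on guard-live carriers, whose `N15At` is then the lane's
theorem outright — model level, said), eventually to NODE 00's [B9] operator layer of the run.

WHAT.  `live_and_n15At_zeroKernels_knitCarriers` (every `L ≥ 1`, `c35`, `p`: the zero-kernel knit carriers are `Live` AND carry `N15At`);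
`exists_reading_keyedLive_n15At_zeroKernels` (SOME Stage-13 rate reading with all NE2 kernels zero passes `KeyedLive` at the bundle of record and carries `N15At` there, for
every run-length selector — the junk inhabitant of the draft's N15 slot, the other slots untouched).

HONEST FRAMING.  Helper lane, count-neutral; a LOCATED VACUITY WITNESS, not a refutation of anything (K3⁷'s text is untouched; the draft is the plan's); nothing of
Bałaban's is asserted; NE2⁺ NOT PRINTED ∕ NOT PROVED; N15 NOT discharged; K3⁷ OPEN, not claimed; counts UNMOVED (typed 28∕28 · discharged 5∕27, A 5∕28); the Yang–Mills
mass gap (Clay) is NOT proved by any of this — R4 closes the conditional finite-𝕋⁴ rung `BalabanLadder.UV` only; nothing continuum ∕ ℝ⁴ ∕ OS.  Restate-immune.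
-/

set_option autoImplicit false

noncomputable section

namespace Summit.QuantumFields.YangMills.BalabanUVNodes.N15.PairedFamilyGuard

open Literature.MathematicalPhysics.QuantumFieldTheory.Balaban1983to89
open Literature.MathematicalPhysics.QuantumFieldTheory.Balaban1983to89.T4Continuum (T4Family ULoop)
open Literature.MathematicalPhysics.QuantumFieldTheory.Balaban1983to89.NE2NodeTorus (KnitIndex knitInstance inAll rhoDist)
open Node00 (Stage13HParams NE2Objects₁₁ RateObjects₁₁ nonempty_rateObjects₁₁)
open YMDAG.UVSplit (NE1pCarriers NE2Carriers RateCarriers N15At ne2OfRecord₁₁ RateReading₁₃CoPH rateCarriersOfRecord₁₃CoPH)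

/-! ## The zero-kernel reading: live carriers, no estimate, `N15At` -/

/-- **ZERO KERNELS ON THE LIVE KNIT CARRIERS PASS THE GUARD AND CARRY `N15At`** (every `L ≥ 1`, `c35`, `p`): the carriers are `NE2NodeTorus.knitInstance 3 L` (cube size
`i.M ≥ 1` and scale count free ⇒ `cofinal`; one-point backgrounds regular; `inAll` met at the site `0`) — `Live` exactly as `live_knitCarriers` — and the three kernel
families are IDENTICALLY ZERO, so `N15At` holds by file 1's `n15At_of_kernels_zero` (the torus carrier's `η = (L^k)⁻¹`, `L`, lengths and sup norms are non-negative).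
Door (J3) as an inhabitant: `Live` does not see kernels. [bookkeeping] -/
theorem live_and_n15At_zeroKernels_knitCarriers (L : ℕ) [NeZero L] (c35 p : ℝ) :
    Live ⟨KnitIndex 3 L, c35, p, knitInstance 3 L, fun _ => ⟨0, 0, 0, 0, 0, 0⟩, fun _ => ⟨0⟩, fun _ => ⟨0⟩, inAll L, rhoDist L⟩ ∧
      N15At ⟨KnitIndex 3 L, c35, p, knitInstance 3 L, fun _ => ⟨0, 0, 0, 0, 0, 0⟩, fun _ => ⟨0⟩, fun _ => ⟨0⟩, inAll L, rhoDist L⟩ := by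
  have hL0 : (0 : ℝ) ≤ (L : ℝ) := Nat.cast_nonneg L
  refine ⟨⟨fun M₅ k₀ => ?_, fun _ _ _ => ⟨trivial, trivial⟩, fun i => ?_⟩, ?_⟩
  · exact ⟨⟨{ k := k₀, N := fun _ => L, M := max 1 M₅, one_le := le_max_left _ _ }, fun _ => dvd_rfl⟩, le_max_right 1 M₅, le_rfl⟩
  · haveI := i.1.neZero
    exact ⟨fun _ => 0, trivial⟩
  · refine n15At_of_kernels_zero _ (fun i => ?_) (fun _ => hL0) (fun i y => ?_) (fun i lam => ?_) (fun _ _ _ _ _ => rfl) (fun _ _ _ _ => rfl)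
      (fun _ _ _ _ => rfl)
    · haveI := i.1.neZero
      show (0 : ℝ) ≤ ((L : ℝ) ^ i.1.k)⁻¹
      positivity
    · haveI := i.1.neZero
      show (0 : ℝ) ≤ (L : ℝ) ^ i.1.k * ((L : ℝ) ^ i.1.k)⁻¹
      positivity
    · haveI := i.1.neZero
      exact Finset.le_sup'_of_le _ (Finset.mem_univ (0 : _)) (abs_nonneg _)

variable {N : ℕ} [NeZero N]

/-- ★ **R3 — THE JUNK INHABITANT OF THE DRAFT's N15 SLOT THAT PASSES `GuardedReading`'s `KeyedLive`**: for every `c35`, `p` there is a Stage-13 rate reading `𝔯` whose NE2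
objects at every tuple and run length are the zero-kernel knit objects on `KnitIndex 3 2` (the other rate objects = RR-1's sanity inhabitant, the dressed tower empty —
fillers, displayed in the proof) such that FOR EVERY run-length selector `ksel`: `KeyedLive` holds at the bundle of record AND `N15At` holds there — with ALL THREE KERNEL
FAMILIES ZERO.  So in plan g79's DRAFT-2 the conjunct `N15At (rrOfRecord 𝔯 ksel …).ne2` of `KeyedRatesHolderD4` is closable WITHOUT AN ESTIMATE even under `GuardedReading`
(as far as the N15 slot goes; the other slots are not touched here).  Cure: pin the objects INCLUDING THE KERNELS by name (dag-n15-a PROGRAMME S sized genuine family today;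
NODE 00's [B9] layer eventually) — not a further carrier guard. [bookkeeping] -/
theorem exists_reading_keyedLive_n15At_zeroKernels (c35 p : ℝ) :
    ∃ 𝔯 : RateReading₁₃CoPH N,
      (∀ (F : T4Family) (θ : Stage13HParams F N) (hP : θ.Provisos₁₃CoPH F N) (g₀ : ℕ → ℝ) (os : List (ULoop F)) (k : ℕ),
        (∀ (i : ((𝔯.lit F θ hP g₀ os).ne2 k).I) n U lam y, (((𝔯.lit F θ hP g₀ os).ne2 k).Kop i).e n U lam y = 0) ∧
        (∀ (i : ((𝔯.lit F θ hP g₀ os).ne2 k).I) U y y', (((𝔯.lit F θ hP g₀ os).ne2 k).Ksite i).ker U y y' = 0) ∧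
        (∀ (i : ((𝔯.lit F θ hP g₀ os).ne2 k).I) U y y', (((𝔯.lit F θ hP g₀ os).ne2 k).Kunit i).ker U y y' = 0)) ∧
      ∀ ksel : (F : T4Family) → (θ : Stage13HParams F N) → θ.Provisos₁₃CoPH F N → (ℕ → ℝ) → List (ULoop F) → ℕ,
        KeyedLive (fun F θ hP g₀ os => rateCarriersOfRecord₁₃CoPH 𝔯 F θ hP g₀ os (ksel F θ hP g₀ os)) ∧
        ∀ (F : T4Family) (θ : Stage13HParams F N) (hP : θ.Provisos₁₃CoPH F N) (g₀ : ℕ → ℝ) (os : List (ULoop F)),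
          N15At (rateCarriersOfRecord₁₃CoPH 𝔯 F θ hP g₀ os (ksel F θ hP g₀ os)).ne2 := by
  obtain ⟨r₀⟩ := nonempty_rateObjects₁₁ (N := N)
  let o : NE2Objects₁₁ := ⟨KnitIndex 3 2, c35, p, knitInstance 3 2, fun _ => ⟨0, 0, 0, 0, 0, 0⟩, fun _ => ⟨0⟩, fun _ => ⟨0⟩, inAll 2, rhoDist 2⟩
  let 𝔯 : RateReading₁₃CoPH N :=
    ⟨fun _ _ _ _ _ => ⟨r₀.u3, r₀.ne3, fun _ => o⟩, fun _ _ _ _ _ => (⟨Empty, ⟨fun q => q.elim, fun q => q.elim, fun q => q.elim⟩, 0⟩ : NE1pCarriers)⟩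
  have key := live_and_n15At_zeroKernels_knitCarriers 2 c35 p
  exact ⟨𝔯, fun F θ hP g₀ os k => ⟨fun _ _ _ _ _ => rfl, fun _ _ _ _ => rfl, fun _ _ _ _ => rfl⟩,
    fun ksel => ⟨fun F θ hP _ _ g₀ os => key.1, fun F θ hP g₀ os => key.2⟩⟩

end Summit.QuantumFields.YangMills.BalabanUVNodes.N15.PairedFamilyGuard

end
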